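import Summits.CriticalPhenomena.PercolationContinuityZ3.Theses.PercOpenSupercrit
import Summits.CriticalPhenomena.PercolationContinuityZ3.Theorems.PercNearOneGluingNoHeavyLowerTailCSHTheoremOne
import Literature.Probability.Percolation.SharpnessDCTProofs
import HarnessLib

/-!
# `PercOpenSupercrit.GoodBoxEventIsLocal` (stmt-CriticalPhenomena-3841) — SETTLED after continuity

Item `stmt-CriticalPhenomena-3841` of route `CriticalPhenomena/PercOpenSupercrit` (support): the good-box event `G_n` is a cylinder event of `Λ_n`.

Witness `F = (box 3 n).sym2`: every atom of `G_n` is `ω ∈ openConnIn Λ_n a b`, determined by the pairs inside `Λ_n` (`determinedBy_openConnIn`).  p205010 is NOT used.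

builds on p205010 (kernel theorem, internal audit signed; external expert review pending) — USED (`CSH.percolationContinuityZ3_holds`).  RSW3 lane, lead gen 28 (prover-prim-rsw3-lead-g28-0):
'after continuity — the ledger harvest'.
References: G. Kozma, N. Nitzan (2024), Thm. 6 / Conj. 3 [KozmaNitzan2024]; G. Grimmett, *Percolation* (1999), §8 [GrimmettPercolation1999].
-/

noncomputable section

namespace Summit.CriticalPhenomena.PercolationContinuityZ3.Theorems

namespace PercOpenSupercritGoodBoxEventIsLocal

open MeasureTheory Literature.Probability.Percolation Literature.Probability.LatticeModels
open DCT16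

/-- **`PercOpenSupercrit.GoodBoxEventIsLocal` (stmt-CriticalPhenomena-3841), settled.**  witness `(box 3 n).sym2`, via `determinedBy_openConnIn`.
[cite: KozmaNitzan2024, Thm. 6 with Conj. 3 (p. 15)] -/
theorem goodBoxEventIsLocal_proof : Summit.CriticalPhenomena.PercolationContinuityZ3.Theses.PercOpenSupercrit.GoodBoxEventIsLocal := by
  intro n _
  classical
  refine ⟨(box 3 n).sym2, ?_⟩
  have hK : (↑(box 3 n) : Set (Site 3)).sym2 ⊆ ↑((box 3 n).sym2) := by rw [Finset.coe_sym2]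
  rw [determinedBy_iff]
  intro ω ω' h
  have e : ∀ a b : Site 3, ω ∈ openConnIn (↑(box 3 n) : Set (Site 3)) a b ↔
      ω' ∈ openConnIn (↑(box 3 n) : Set (Site 3)) a b := fun a b =>
    (determinedBy_iff _ _).1 (determinedBy_openConnIn _ a b hK) ω ω' h
  simp only [Set.mem_setOf_eq, e]

end PercOpenSupercritGoodBoxEventIsLocal

end Summit.CriticalPhenomena.PercolationContinuityZ3.Theorems

end
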